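import Summits.BirchSwinnertonDyer.BirchSwinnertonDyer.Theorems.KolyvaginDepthDoorKolyvaginDepthSupplyZhangGrossPowInvolution
import Summits.BirchSwinnertonDyer.Rank1Residual.JET.ZhangKolyvaginPrimeGross
import Literature.NumberTheory.EllipticCurves.HeegnerPointsKolyvaginPrimaryEigenProofs
import HarnessLib

/-!
# Route `KolyvaginDepthDoor` (stmt-BirchSwinnertonDyer-21765) — W. ZHANG'S KOLYVAGIN PRIMES OF INDEX
# `≥ M` ARE GROSS'S OF LEVEL `M`: `Frob(ℓ) = Frob(∞)` in `Gal(K(E[p^M])/ℚ)` from `p^M ∣ ℓ + 1`,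
# `p^M ∣ a_ℓ`, under `ρ_{E,p^M}` onto (odd `p`)

Helper file (`--supports stmt-BirchSwinnertonDyer-21765 --as helper`); it closes nothing and BSD is
not proved by it.

McCallum 1991, §4 (p. 299): *"`S_r(M)` … `Frob(l) = Frob(∞)` in `Gal(ℚ(E_{p^M})/ℚ)` … this implies
that `p^M` divides both `l + 1` and `a_l`"*; Gross 1991, §3 (p. 239): *"The implication
`Frob(ℓ) = Frob(∞)` in `Gal(ℚ(E_p)/ℚ)` is equivalent to the congruences (3.3)"*. The tree has the
implication at every level (`pow_dvd_add_one_of_frobEqFrobInfty`, `pow_dvd_frobeniusTraceAt_of_frobEqFrobInfty`)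
and the converse at level `p` only (`JET.ZhangGross.frobEqFrobInfty_of_zhang`). THIS FILE proves the
converse at every level `p^M` when `ρ_{E,p^M} : Γ_ℚ → Aut(E[p^M])` is onto (the tower hypothesis of
the McCallum leaves / of W. Zhang 2014):

* `frobEqFrobInfty_pow_of_zhang` — `Zhang2014.IsKolyvaginPrime N_E W K p ℓ`, `M ≤ M(ℓ)`,
  `ρ_{E,p^M}` onto, `p` odd, `K` imaginary quadratic ⟹ `FrobEqFrobInfty W K (p^M) ℓ` (the level-`p`
  surjectivity is not needed: the conjugation is done at level `p^M` directly).
  Proof: a Frobenius `h₀` above `ℓ` is an involution of `E[p^M]` (PART 1,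
  `frob_smul_smul_eq_self_of_pow_dvd`: trace `a_ℓ ≡ 0`, determinant `ℓ ≡ −1`); so is a complex
  conjugation `c₀`; both have non-zero `p`-torsion eigenvectors of both signs (level `p`: `det = −1`,
  the tree's `RatClosure.exists_eigenvectors` / `det_galoisRepTorsion_frobenius_eq`), hence both
  eigen-parts of `E[p^M]` are CYCLIC OF ORDER `p^M` for either involution
  (`KolyvaginEigenPow.exists_eigen_generators`, McCallum's Lemma 5.3 count); the generator pairs are
  `ℤ/p^M`-bases of `E[p^M]`, the base change between them commutes with the involutions, and it is
  `ρ_{E,p^M}(g)` for some `g ∈ Γ_ℚ`; `h = g h₀ g⁻¹` is a Frobenius above `ℓ` acting as `c₀` on `E[p^M]`,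
  and on `K` both restrict to the non-trivial automorphism (`ℓ` inert; verbatim the level-`p` proof).
* `isKolyvaginPrime_and_frobEqFrobInfty_pow_of_zhang` — the pair consumed by the x11b3 ENDs
  (`IsKolyvaginPrime N_E W K p ℓ ∧ FrobEqFrobInfty W K (p^M) ℓ`).

References: [GrossLMS1991] §3 (3.1)–(3.3); [McCallumLMS1991] §4, §5 Lemma 5.3; [WZhang2014]
Notations (xii); [SilvermanAEC2009] III §7, C.21 Remark 21.3.
-/

set_option linter.dupNamespace false

noncomputable section

open scoped Classical Pointwise

namespace Summit.BirchSwinnertonDyer.BirchSwinnertonDyer.Theorems.KolyvaginDepthDoor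

open WeierstrassCurve Field Function NumberField IsDedekindDomain Rat.HeightOneSpectrum
open Literature.NumberTheory.EllipticCurves Literature.NumberTheory.GaloisRepresentations Module
open Summit.BirchSwinnertonDyer.Rank1Residual.X11b.Three.Koly.Method2
open Summit.BirchSwinnertonDyer.Rank1Residual.X11b.Three.Koly.Method2.KolyLocal
open Summit.BirchSwinnertonDyer.Rank1Residual.JET.ZhangGross

section Gross

variable (W : WeierstrassCurve ℚ) [W.IsElliptic] [W.IsGloballyMinimal] (K : Type) [Field K]
  [NumberField K]

/-- **W. Zhang's Kolyvagin primes of index `≥ M` satisfy Gross's (3.2) modulo `p^M`** when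
`ρ_{E,p^M}` is onto (`p` odd, `K` imaginary quadratic, `M ≥ 1`): `FrobEqFrobInfty W K (p^M) ℓ`.
Proof: module docstring. [cite: McCallumLMS1991, §4 (p. 299), §5 Lemma 5.3]
[cite: GrossLMS1991, §3 (3.2)–(3.3)] [cite: WZhang2014, Notations (xii)] -/
theorem frobEqFrobInfty_pow_of_zhang (hK : IsImaginaryQuadratic K) {p : ℕ} [Fact p.Prime]
    (hp2 : p ≠ 2) {M : ℕ} (hM : 1 ≤ M)
    (hsurjM : W.HasSurjectiveModNGaloisRep (p ^ M : ℕ)) {ℓ : ℕ}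
    (hℓ : Zhang2014.IsKolyvaginPrime (W.conductorNorm ℤ) W K p ℓ)
    (hℓM : M ≤ Zhang2014.kolyvaginIndex W p ℓ) : FrobEqFrobInfty W K (p ^ M) ℓ := by
  have hp : p.Prime := Fact.out
  obtain ⟨n, rfl⟩ : ∃ n, M = n + 1 := ⟨M - 1, by omega⟩
  haveI : Fact (2 < p) := ⟨lt_of_le_of_ne hp.two_le (Ne.symm hp2)⟩
  have hne1 : (-1 : ZMod p) ≠ 1 := ZMod.neg_one_ne_one
  haveI : Algebra.IsQuadraticExtension ℚ K := ⟨hK.1⟩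
  haveI : IsTotallyComplex K := hK.2
  have hℓp : ℓ.Prime := hℓ.1
  haveI : Fact ℓ.Prime := ⟨hℓp⟩
  have hℓ3 : ℓ ≠ p := hℓ.2.2.2.1
  have hℓP : (Ideal.span {(ℓ : 𝓞 K)}).IsPrime := hℓ.2.2.2.2.1
  have hdvd := Zhang2014.IsKolyvaginPrime.dvd (p := p) hℓ
  have hdvdM := (Zhang2014.le_kolyvaginIndex_iff (W := W) (p := p)).mp hℓM
  set N : ℕ := p ^ (n + 1) with hN
  haveI : NeZero N := ⟨pow_ne_zero _ hp.ne_zero⟩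
  -- ### places: `w = (ℓ)` in `K`, `v₁` below it in `ℚ`, a prime `𝔓 ∣ w` of `\bar ℤ_K`, `𝔓' = 𝔓 ∩ \bar ℤ`
  let w : HeightOneSpectrum (𝓞 K) := ⟨Ideal.span {(ℓ : 𝓞 K)}, hℓP, by
    rw [Ne, Ideal.span_singleton_eq_bot]; exact_mod_cast hℓp.ne_zero⟩
  have hw : (ℓ : 𝓞 K) ∈ w.asIdeal := Ideal.mem_span_singleton_self _
  set v₁ : HeightOneSpectrum (𝓞 ℚ) := w.under (𝓞 ℚ) with hv₁
  have hwv₁ : w.asIdeal.under (𝓞 ℚ) = v₁.asIdeal := rfl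
  have hℓv₁ : (ℓ : 𝓞 ℚ) ∈ v₁.asIdeal := by
    rw [← hwv₁, Ideal.under_def, Ideal.mem_comap, map_natCast]; exact hw
  have hv₁ℓ : (primesEquiv v₁ : ℕ) = ℓ := primesEquiv_eq_of_natCast_mem hℓp hℓv₁
  obtain ⟨𝔐, h𝔐⟩ := w.localPrimesAbove_nonempty
  set 𝔓 := w.primeBelow (closureEmb (K := K) (w.adicCompletion K)) 𝔐 with h𝔓def
  have h𝔓 : 𝔓 ∈ w.primesAbove := HeightOneSpectrum.primeBelow_mem_primesAbove h𝔐
  set 𝔓' := 𝔓.comap (absIntegersMap ℚ K) with h𝔓'def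
  have h𝔓' : 𝔓' ∈ v₁.primesAbove := comap_absIntegersMap_mem_primesAbove hwv₁ h𝔓
  have hgoodv : W.HasGoodReductionAt v₁ :=
    LocalFrob.hasGoodReductionAt_rat_of_not_dvd_conductorNorm W hℓp hℓ.2.1 v₁ hℓv₁
  have hgood : W.HasGoodReductionAtPrime ℓ :=
    (hasGoodReductionAtPrime_primesEquiv_iff_holds W v₁ ℓ hv₁ℓ).mpr hgoodv
  -- ### the two involutions: a Frobenius `h₀` above `ℓ` and a complex conjugation `c₀`
  obtain ⟨h₀, hh₀⟩ := HeightOneSpectrum.exists_isArithFrobAt_of_mem_primesAbove_holds h𝔓'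
  obtain ⟨c₀, hc₀⟩ := exists_isComplexConjugation (Rat.castHom ℝ)
  -- level `p`: `h₀² = 1` on `E[p]`, eigenvectors of both signs for `h₀` and `c₀`
  have hA2 : ∀ P : geomTorsion W ((p : ℕ) : ℤ), h₀ • h₀ • P = P := fun P ↦
    frob_sq_smul_eq_self_of_dvd W hℓ3 hgood hdvd.1 hdvd.2 hv₁ℓ h𝔓' hh₀ P
  have hWp : W.exists_weilPairing p := exists_weilPairing_holds W p
  obtain ⟨⟨b₁, hb₁0, hb₁⟩, ⟨b₂, hb₂0, hb₂⟩⟩ := RatClosure.exists_eigenvectors W hc₀ hWp hp2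
  letI : Module (ZMod p) (geomTorsion W ((p : ℕ) : ℤ)) := AddSubgroup.torsionBy.zmodModule
  have h2 : Module.finrank (ZMod p) (geomTorsion W ((p : ℕ) : ℤ)) = 2 :=
    Literature.RepresentationTheory.FiniteGroups.Representation.finrank_eq_two_of_natCard_eq_sq
      (card_torsionPoints_eq_sq_holds W (AlgebraicClosure ℚ) (n := p)
        (by exact_mod_cast hp.ne_zero))
  haveI : FiniteDimensional (ZMod p) (geomTorsion W ((p : ℕ) : ℤ)) :=
    Module.finite_of_finrank_eq_succ h2
  set f := (galoisRepTorsion W ((p : ℕ) : ℤ) h₀).toAdd.toAddMonoidHom.toZModLinearMap p with hfdef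
  have hf : ∀ Q, f Q = h₀ • Q := fun Q => rfl
  have hdet : LinearMap.det f = (ℓ : ZMod p) :=
    W.det_galoisRepTorsion_frobenius_eq p hℓ3 hgood hv₁ℓ h𝔓' hh₀
  have hℓm : (ℓ : ZMod p) = -1 := by
    have h3 : ((ℓ + 1 : ℕ) : ZMod p) = 0 := by rw [ZMod.natCast_eq_zero_iff]; exact hdvd.1
    rw [Nat.cast_add, Nat.cast_one] at h3
    exact eq_neg_of_add_eq_zero_left h3
  have hnot_id : ¬ ∀ P : geomTorsion W ((p : ℕ) : ℤ), h₀ • P = P := by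
    intro hall
    have hfid : f = LinearMap.id := LinearMap.ext fun P ↦ by rw [hf, hall]; rfl
    have : LinearMap.det f = 1 := by rw [hfid, LinearMap.det_id]
    rw [hdet, hℓm] at this
    exact hne1 this
  have hnot_neg : ¬ ∀ P : geomTorsion W ((p : ℕ) : ℤ), h₀ • P = -P := by
    intro hall
    have hfid : f = (-1 : ZMod p) • LinearMap.id := LinearMap.ext fun P ↦ by
      rw [hf, hall, LinearMap.smul_apply, LinearMap.id_apply, neg_one_smul]
    have : LinearMap.det f = 1 := by
      rw [hfid, LinearMap.det_smul, LinearMap.det_id, h2]; norm_num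
    rw [hdet, hℓm] at this
    exact hne1 this
  obtain ⟨u, hu⟩ := not_forall.mp hnot_neg
  obtain ⟨u', hu'⟩ := not_forall.mp hnot_id
  have ha₁ : h₀ • (h₀ • u + u) = h₀ • u + u := by rw [smul_add, hA2, add_comm]
  have ha₁0 : h₀ • u + u ≠ 0 := fun h0 ↦ hu (eq_neg_of_add_eq_zero_left h0)
  have ha₂ : h₀ • (h₀ • u' - u') = -(h₀ • u' - u') := by rw [smul_sub, hA2, neg_sub]
  have ha₂0 : h₀ • u' - u' ≠ 0 := fun h0 ↦ hu' (sub_eq_zero.mp h0)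
  -- ### level `p^{n+1}`: `T = E[p^{n+1}]`, both involutions, eigen-generators, the conjugator
  set T := geomTorsion W ((N : ℕ) : ℤ) with hTdef
  -- `h₀² = 1` on `T` (PART 1) and `c₀² = 1`
  have haℓ : ((p : ℤ) ^ (n + 1)) ∣ W.frobeniusTraceAt v₁ := by
    rw [frobeniusTraceAt_eq_frobeniusTrace W v₁, show ((primesEquiv v₁ : ℕ)) = ℓ from hv₁ℓ]
    exact_mod_cast hdvdM.2
  have hA2N : ∀ P : T, h₀ • h₀ • P = P := fun P ↦ by
    apply Subtype.ext
    exact frob_smul_smul_eq_self_of_pow_dvd W n hℓp hℓ3 hℓv₁ hgoodv h𝔓' hh₀ hdvdM.1 haℓ P.2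
  have hC2N : ∀ P : T, c₀ • c₀ • P = P := fun P ↦ by
    rw [← mul_smul, ← pow_two, hc₀.sq_eq_one, one_smul]
  let ι₁ : T →+ T := DistribSMul.toAddMonoidHom T h₀
  let ι₂ : T →+ T := DistribSMul.toAddMonoidHom T c₀
  have hι₁ : ∀ x, ι₁ x = h₀ • x := fun x ↦ rfl
  have hι₂ : ∀ x, ι₂ x = c₀ • x := fun x ↦ rfl
  -- `T` is killed by `p^{n+1}`, has order `p^{2(n+1)}`, and `T[p] = E[p]` has order `p²`
  have hTN : ∀ t : T, p ^ (n + 1) • t = 0 := fun t ↦ by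
    have := (mem_geomTorsion_iff W ((N : ℕ) : ℤ) _).mp t.2
    apply Subtype.ext
    rw [AddSubgroupClass.coe_nsmul, ← natCast_zsmul]
    exact this
  have hcardT : Nat.card T = p ^ (2 * (n + 1)) := by
    have h : Nat.card T = N ^ 2 :=
      card_torsionPoints_eq_sq_holds W (AlgebraicClosure ℚ) (n := N) (by exact_mod_cast NeZero.ne N)
    rw [h, hN, ← pow_mul, mul_comm]
  haveI : Finite T := Nat.finite_of_card_ne_zero (by rw [hcardT]; exact pow_ne_zero _ hp.ne_zero)
  -- the inclusion `E[p] ⊆ E[p^{n+1}]`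
  have hmemN : ∀ P : geomTorsion W ((p : ℕ) : ℤ), (P : W.geomPoints) ∈ T := fun P ↦ by
    have hP := (mem_geomTorsion_iff W ((p : ℕ) : ℤ) (P : W.geomPoints)).mp P.2
    rw [hTdef, mem_geomTorsion_iff, hN, Nat.cast_pow, pow_succ, mul_smul, hP, smul_zero]
  let incl : geomTorsion W ((p : ℕ) : ℤ) → T := fun P ↦ ⟨P, hmemN P⟩
  have hincl0 : ∀ {P : geomTorsion W ((p : ℕ) : ℤ)}, P ≠ 0 → incl P ≠ 0 := fun {P} hP h0 ↦ by
    have h1 : ((incl P : T) : W.geomPoints) = ((0 : T) : W.geomPoints) := congrArg Subtype.val h0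
    exact hP (Subtype.ext h1)
  have hinclp : ∀ P : geomTorsion W ((p : ℕ) : ℤ), p • incl P = 0 := fun P ↦ by
    apply Subtype.ext
    rw [AddSubgroupClass.coe_nsmul, ← natCast_zsmul]
    exact (mem_geomTorsion_iff W ((p : ℕ) : ℤ) _).mp P.2
  have hincl_smul : ∀ (g : absoluteGaloisGroup ℚ) (P : geomTorsion W ((p : ℕ) : ℤ)),
      g • incl P = incl (g • P) := fun g P ↦ Subtype.ext rfl
  have hcardp : Nat.card {x : T // p • x = 0} = p ^ 2 := by
    have e : {x : T // p • x = 0} ≃ geomTorsion W ((p : ℕ) : ℤ) :=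
      { toFun := fun x ↦ ⟨(x.1 : W.geomPoints), by
          have h := congrArg Subtype.val x.2
          simp only [AddSubgroupClass.coe_nsmul, ZeroMemClass.coe_zero] at h
          rw [mem_geomTorsion_iff, natCast_zsmul]
          exact h⟩
        invFun := fun P ↦ ⟨incl P, hinclp P⟩
        left_inv := fun x ↦ Subtype.ext (Subtype.ext rfl)
        right_inv := fun P ↦ Subtype.ext rfl }
    rw [Nat.card_congr e]
    exact card_torsionPoints_eq_sq_holds W (AlgebraicClosure ℚ) (n := p)
      (by exact_mod_cast hp.ne_zero)
  -- eigen-generators for `h₀` and for `c₀` (McCallum's Lemma 5.3 count)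
  obtain ⟨u₁, w₁, hu₁, hw₁, -, -, hspan₁, hou₁, how₁⟩ :=
    KolyvaginEigenPow.exists_eigen_generators hp hp2 hTN hcardT hcardp ι₁
      (fun x ↦ by rw [hι₁, hι₁, hA2N])
      (hincl0 ha₁0) (hinclp _) (by rw [hι₁, hincl_smul, ha₁])
      (hincl0 ha₂0) (hinclp _) (by
        rw [hι₁, hincl_smul, ha₂]; exact Subtype.ext rfl)
  obtain ⟨u₂, w₂, hu₂, hw₂, -, -, hspan₂, hou₂, how₂⟩ :=
    KolyvaginEigenPow.exists_eigen_generators hp hp2 hTN hcardT hcardp ι₂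
      (fun x ↦ by rw [hι₂, hι₂, hC2N])
      (hincl0 hb₁0) (hinclp _) (by rw [hι₂, hincl_smul, hb₁])
      (hincl0 hb₂0) (hinclp _) (by
        rw [hι₂, hincl_smul, hb₂]; exact Subtype.ext rfl)
  -- `ℤ/p^{n+1}`-bases `(u₁, w₁)`, `(u₂, w₂)` of `T`
  letI : Module (ZMod N) T := AddSubgroup.torsionBy.zmodModule
  have hsmulval : ∀ (s : ZMod N) (x : T), s • x = s.val • x := fun s x ↦ by
    conv_lhs => rw [← ZMod.natCast_zmod_val s]
    exact Nat.cast_smul_eq_nsmul (ZMod N) s.val x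
  have hbasis : ∀ (ι : T →+ T) (u w : T), ι u = u → ι w = -w →
      (∀ z, ∃ β δ : ℤ, z = β • u + δ • w) → addOrderOf u = p ^ (n + 1) →
      addOrderOf w = p ^ (n + 1) →
      LinearIndependent (ZMod N) ![u, w] ∧ ⊤ ≤ Submodule.span (ZMod N) (Set.range ![u, w]) := by
    intro ι u w hu hw hspan hou how
    refine ⟨LinearIndependent.pair_iff.mpr fun s t hst ↦ ?_, fun z _ ↦ ?_⟩
    · -- `s • u = -(t • w)` lies in both eigen-parts, hence is `0`
      rw [hsmulval, hsmulval] at hst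
      have hy : ι (s.val • u) = s.val • u := by rw [map_nsmul, hu]
      have hy' : ι (s.val • u) = -(s.val • u) := by
        rw [eq_neg_of_add_eq_zero_left hst, map_neg, map_nsmul, hw, smul_neg, neg_neg]
      have h2y : 2 • (s.val • u) = 0 := by
        rw [two_nsmul]
        nth_rw 2 [← hy]
        rw [hy', add_neg_cancel]
      have hsu : s.val • u = 0 := KolyvaginEigenPow.eq_zero_of_two_nsmul_eq_zero hp hp2 hTN h2y
      have htw : t.val • w = 0 := by rwa [hsu, zero_add] at hst
      have hs : s = 0 := by
        have hd : p ^ (n + 1) ∣ s.val := hou ▸ addOrderOf_dvd_of_nsmul_eq_zero hsu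
        have hlt : s.val < p ^ (n + 1) := hN ▸ ZMod.val_lt s
        have : s.val = 0 := Nat.eq_zero_of_dvd_of_lt hd hlt
        exact (ZMod.val_eq_zero s).mp this
      have ht : t = 0 := by
        have hd : p ^ (n + 1) ∣ t.val := how ▸ addOrderOf_dvd_of_nsmul_eq_zero htw
        have hlt : t.val < p ^ (n + 1) := hN ▸ ZMod.val_lt t
        have : t.val = 0 := Nat.eq_zero_of_dvd_of_lt hd hlt
        exact (ZMod.val_eq_zero t).mp this
      exact ⟨hs, ht⟩
    · obtain ⟨β, δ, hz⟩ := hspan z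
      rw [hz, ← Int.cast_smul_eq_zsmul (ZMod N) β u, ← Int.cast_smul_eq_zsmul (ZMod N) δ w]
      exact Submodule.add_mem _
        (Submodule.smul_mem _ _ (Submodule.subset_span ⟨0, rfl⟩))
        (Submodule.smul_mem _ _ (Submodule.subset_span ⟨1, rfl⟩))
  obtain ⟨hli₁, hsp₁⟩ := hbasis ι₁ u₁ w₁ hu₁ hw₁ hspan₁ hou₁ how₁
  obtain ⟨hli₂, hsp₂⟩ := hbasis ι₂ u₂ w₂ hu₂ hw₂ hspan₂ hou₂ how₂
  let bA := Module.Basis.mk hli₁ hsp₁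
  let bB := Module.Basis.mk hli₂ hsp₂
  have hbA0 : bA 0 = u₁ := by rw [Module.Basis.coe_mk]; rfl
  have hbA1 : bA 1 = w₁ := by rw [Module.Basis.coe_mk]; rfl
  have hbB0 : bB 0 = u₂ := by rw [Module.Basis.coe_mk]; rfl
  have hbB1 : bB 1 = w₂ := by rw [Module.Basis.coe_mk]; rfl
  let Φ : T ≃ₗ[ZMod N] T := bA.equiv bB (Equiv.refl _)
  have hΦ0 : Φ u₁ = u₂ := by rw [← hbA0, Module.Basis.equiv_apply, Equiv.refl_apply, hbB0]
  have hΦ1 : Φ w₁ = w₂ := by rw [← hbA1, Module.Basis.equiv_apply, Equiv.refl_apply, hbB1]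
  -- `Φ ∘ h₀ = c₀ ∘ Φ`
  set f₁ := ι₁.toZModLinearMap N with hf₁def
  set f₂ := ι₂.toZModLinearMap N with hf₂def
  have hf₁ : ∀ Q, f₁ Q = h₀ • Q := fun Q => rfl
  have hf₂ : ∀ Q, f₂ Q = c₀ • Q := fun Q => rfl
  have hΦA : ∀ P, Φ (h₀ • P) = c₀ • Φ P := by
    have hlin : Φ.toLinearMap ∘ₗ f₁ = f₂ ∘ₗ Φ.toLinearMap := by
      refine bA.ext fun i ↦ ?_
      fin_cases i
      · change Φ (f₁ (bA 0)) = f₂ (Φ (bA 0))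
        rw [hf₁, hf₂, hbA0, ← hι₁, hu₁, hΦ0, ← hι₂, hu₂]
      · change Φ (f₁ (bA 1)) = f₂ (Φ (bA 1))
        rw [hf₁, hf₂, hbA1, ← hι₁, hw₁, map_neg, hΦ1, ← hι₂, hw₂]
    intro P
    have := congrArg (fun f ↦ f P) hlin
    simpa only [LinearMap.comp_apply, LinearEquiv.coe_coe, hf₁, hf₂] using this
  -- the conjugator `g` with `ρ_{E,p^{n+1}}(g) = Φ`
  obtain ⟨g, hg⟩ := hsurjM (Multiplicative.ofAdd Φ.toAddEquiv)
  have hgP : ∀ P : T, g • P = Φ P := fun P ↦ by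
    have := congrArg (fun φ ↦ (Multiplicative.toAdd φ) P) hg
    simpa using this
  set h := g * h₀ * g⁻¹ with hhdef
  have hhP : ∀ P : T, h • P = c₀ • P := fun P ↦ by
    have hg' : g⁻¹ • P = Φ.symm P := by
      rw [inv_smul_eq_iff, hgP, LinearEquiv.apply_symm_apply]
    rw [hhdef, mul_smul, mul_smul, hg', hgP, hΦA, LinearEquiv.apply_symm_apply]
  have hhFrob : IsArithFrobAt (𝓞 ℚ) h (g • 𝔓') := hh₀.conj g
  -- ### on `K`: `h` and `c₀` both restrict to the non-trivial automorphism
  letI : Algebra K (AlgebraicClosure ℚ) := (absEmbedding ℚ K).toRingHom.toAlgebra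
  haveI : IsScalarTower ℚ K (AlgebraicClosure ℚ) :=
    IsScalarTower.of_algebraMap_eq fun q ↦ ((absEmbedding ℚ K).commutes q).symm
  let r : absoluteGaloisGroup ℚ →* (K ≃ₐ[ℚ] K) :=
    (AlgEquiv.restrictNormalHom K).comp (absoluteGaloisGroup.toAlgEquiv ℚ).toMonoidHom
  have hr : ∀ (σ : absoluteGaloisGroup ℚ) (x : K), σ • absEmbedding ℚ K x = absEmbedding ℚ K (r σ x) :=
    fun σ x ↦ by
    have := AlgEquiv.restrictNormal_commutes (absoluteGaloisGroup.toAlgEquiv ℚ σ) K x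
    rw [absoluteGaloisGroup.smul_def]
    exact this.symm
  have hrange : ∀ σ : absoluteGaloisGroup ℚ, r σ = 1 → σ ∈ (absGaloisRestrict ℚ K).range := by
    intro σ hσ
    rw [mem_range_absGaloisRestrict_iff_smul_absEmbedding]
    intro x
    rw [hr, hσ, AlgEquiv.one_apply]
  have hf2 := LocalFrob.inertiaDeg_eq_two_of_isPrime_span K hK.1 hℓp hℓP w hw
  have hrh₀ : r h₀ ≠ 1 := by
    intro h1
    obtain ⟨τ, hτ⟩ := MonoidHom.mem_range.mp (hrange h₀ h1)
    have hτ' : absGaloisRestrict ℚ K τ = h₀ := hτ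
    have hf1 := inertiaDeg_eq_one_of_isArithFrobAt_absGaloisRestrict (F := ℚ) (M := K) hwv₁ h𝔓 (τ := τ)
      (by rw [hτ']; exact hh₀)
    rw [hf2] at hf1
    exact absurd hf1 (by norm_num)
  have hrc₀ : r c₀ ≠ 1 := fun h1 ↦
    Rat.not_mem_range_absGaloisRestrict_of_isComplexConjugation K hK.2 hc₀ (hrange c₀ h1)
  have hcard : Nat.card (K ≃ₐ[ℚ] K) = 2 := by rw [IsGalois.card_aut_eq_finrank, hK.1]
  obtain ⟨y, -, hy⟩ := (Nat.card_eq_two_iff' (1 : K ≃ₐ[ℚ] K)).mp hcard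
  have hrh : r h = y := by
    have hrh0 : r h₀ = y := hy _ hrh₀
    rw [hhdef, map_mul, map_mul, map_inv, hrh0]
    by_cases hrg : r g = 1
    · rw [hrg, one_mul, inv_one, mul_one]
    · rw [hy _ hrg, mul_inv_cancel_right]
  have hmem : c₀⁻¹ * h ∈ (absGaloisRestrict ℚ K).range := by
    refine hrange _ ?_
    rw [map_mul, map_inv, hrh, hy _ hrc₀, inv_mul_cancel]
  obtain ⟨τ, hτ⟩ := MonoidHom.mem_range.mp hmem
  have hτ' : absGaloisRestrict ℚ K τ = c₀⁻¹ * h := hτ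
  refine ⟨v₁, g • 𝔓', h, c₀, hℓv₁, smul_mem_primesAbove h𝔓' g, hhFrob, hc₀, hhP, fun e x ↦ ?_⟩
  have hh' : h = c₀ * absGaloisRestrict ℚ K τ := by rw [hτ', mul_inv_cancel_left]
  rw [hh', mul_smul, absGaloisRestrict_smul_apply_eq τ e x]

/-- **The pair consumed by the x11b3 ENDs** at a Zhang–Kolyvagin prime of index `≥ M`:
`IsKolyvaginPrime N_E W K p ℓ ∧ FrobEqFrobInfty W K (p^M) ℓ`. [cite: GrossLMS1991, §3 (3.1)–(3.3)]
[cite: WZhang2014, Notations (xii)] -/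
theorem isKolyvaginPrime_and_frobEqFrobInfty_pow_of_zhang (hK : IsImaginaryQuadratic K) {p : ℕ}
    [Fact p.Prime] (hp2 : p ≠ 2) {M : ℕ} (hM : 1 ≤ M) (hsurj : W.HasSurjectiveModNGaloisRep p)
    (hsurjM : W.HasSurjectiveModNGaloisRep (p ^ M : ℕ)) {ℓ : ℕ}
    (hℓ : Zhang2014.IsKolyvaginPrime (W.conductorNorm ℤ) W K p ℓ)
    (hℓM : M ≤ Zhang2014.kolyvaginIndex W p ℓ) :
    IsKolyvaginPrime (W.conductorNorm ℤ) W K p ℓ ∧ FrobEqFrobInfty W K (p ^ M) ℓ :=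
  ⟨isKolyvaginPrime_of_zhang W K hK hp2 hsurj hℓ,
    frobEqFrobInfty_pow_of_zhang W K hK hp2 hM hsurjM hℓ hℓM⟩

end Gross

end Summit.BirchSwinnertonDyer.BirchSwinnertonDyer.Theorems.KolyvaginDepthDoor

end
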